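import Literature.Topology.FourManifolds.LoopSurgeryHomotopySphere
import Literature.Topology.FourManifolds.SurfaceCappingOrientation
import Literature.Topology.FourManifolds.ImmersionOrientation
import Literature.Topology.FourManifolds.SpinDiffeomorphProofs
import Literature.Topology.FourManifolds.SmoothOrientationGluing
import Literature.Topology.FourManifolds.RechartOrientation
import Literature.Topology.FourManifolds.SmoothOrientationProd
import Literature.Topology.FourManifolds.SmoothOrientationSphereProofs
import Literature.Geometry.Manifold.ModelChange
import HarnessLib

/-!
# Proofs for `LoopSurgeryHomotopySphere.lean`: orientability passes from a circle surgery back to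
# the surgered manifold

Sibling proof file of `Literature/Topology/FourManifolds/LoopSurgeryHomotopySphere.lean`
(D-0014: a named fact `def X : Prop` is discharged as `theorem X_holds : X`).  It proves
`Literature.Topology.FourManifolds.isOrientable_of_isCircleSurgery_four_holds`: the named fact
`isOrientable_of_isCircleSurgery_four` — *if the smooth 4-manifold `P` is obtained from the
smooth 4-manifold `X` by surgery on a circle `ℓ` (`IsCircleSurgery (𝓡 4) (𝓡 4) X P ℓ`) and `P`
is orientable, then `X` is orientable* — HOLDS.

Proof (M. W. Hirsch, *Differential Topology* (1976), Ch. 4 §4, pp. 101–103: induced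
orientations along codimension-`0` immersions; two orientations of a connected manifold agree or
are opposite; Ch. 5 §1: product orientations).  Let `ν : S¹ × ℝ³ ↪ X` be the tube of the surgery
and `jA : X ∖ ℓ(S¹) ↪ P` the first gluing map.  `X` is covered by the open submanifolds
`U = X ∖ ℓ(S¹)` and `V = ν(S¹ × ℝ³)`:
* `U` is orientable — pull back an orientation of `P` along the codimension-`0` embedding `jA`
  (tree: `IsOrientable.of_isSmoothEmbedding`);
* `V` is orientable — `S¹ × ℝ³` is orientable for the product model (tree: `IsOrientable.prod`,
  `isOrientable_sphere_holds`, `isOrientable_euclideanSpace`), hence so is its recharting on `ℝ⁴`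
  (tree: `IsOrientable.rechart`, Lee 2013 Prop. 15.6), which is diffeomorphic — through the
  identity of the recharting and the corestriction of `ν` (tree: `rangeDiffeomorph`) — to `V`
  (tree: `IsOrientable.of_diffeomorph`);
* `U ∩ V = ν(S¹ × (ℝ³ ∖ 0))` is (pre)connected (`S¹` and `ℝ³ ∖ 0` are connected);
so `X` is orientable by the tree's two-set gluing criterion
`IsOrientable.of_opens_cover_of_isPreconnected` (`SurfaceCappingOrientation.lean`).
Everything is proved; no definitions, no named facts.

## References

* M. W. Hirsch, *Differential Topology*, GTM 33 (1976), Ch. 4 §4 (pp. 101–103), Ch. 5 §1.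
  [HirschDT1976]
* J. M. Lee, *Introduction to Smooth Manifolds*, 2nd ed. (2013), Prop. 15.6, Prop. 15.33.
  [LeeSmoothManifolds2013]
-/

noncomputable section

open scoped Manifold ContDiff Topology
open Set Function
open Literature.Geometry.Manifold (Rechart)

namespace Literature.Topology.FourManifolds

/-- `1 < dim ℝⁿ⁺²`. [folklore] -/
private theorem one_lt_rank_euclideanSpace_loopSurgery (n : ℕ) :
    1 < Module.rank ℝ (EuclideanSpace ℝ (Fin (n + 2))) := by
  rw [← Module.finrank_eq_rank, finrank_euclideanSpace, Fintype.card_fin]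
  norm_cast
  omega

/-- **The tube `S¹ × ℝ³` recharted on `ℝ⁴` is an orientable `C^∞` manifold** and its identity map
to the product manifold is a diffeomorphism (Hirsch Ch. 5 §1: product orientation; Lee 2013,
Prop. 15.6: orientations transport along local diffeomorphisms; the recharting API of
`ModelChange.lean` / `RechartOrientation.lean`). [cite: HirschDT1976, Ch. 5 §1] -/
theorem exists_rechart_tube_diffeomorph :
    ∃ (R : Type) (_ : TopologicalSpace R) (_ : ChartedSpace (EuclideanSpace ℝ (Fin 4)) R)
      (_ : IsManifold (𝓡 4) ∞ R), IsOrientable (𝓡 4) R ∧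
      Nonempty (R ≃ₘ⟮𝓡 4, (𝓡 1).prod (𝓡 3)⟯
        (Metric.sphere (0 : EuclideanSpace ℝ (Fin 2)) 1 × EuclideanSpace ℝ (Fin 3))) := by
  let L : (EuclideanSpace ℝ (Fin 1) × EuclideanSpace ℝ (Fin 3)) ≃L[ℝ]
      EuclideanSpace ℝ (Fin 4) := ContinuousLinearEquiv.ofFinrankEq (by simp)
  let f : ModelProd (EuclideanSpace ℝ (Fin 1)) (EuclideanSpace ℝ (Fin 3)) ≃ₜ
      EuclideanSpace ℝ (Fin 4) := L.toHomeomorph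
  have hIf : ∀ x, f x = L (((𝓡 1).prod (𝓡 3)) x) := fun x => rfl
  have hf :=
    Rechart.contMDiff_of_apply_eq_linear (I := (𝓡 1).prod (𝓡 3)) (n := ∞) f L hIf
  have hf' :=
    Rechart.contMDiff_symm_of_apply_eq_linear (I := (𝓡 1).prod (𝓡 3)) (n := ∞) f L hIf
  -- the tube recharted on `ℝ⁴`
  let R : Type :=
    Rechart f (Metric.sphere (0 : EuclideanSpace ℝ (Fin 2)) 1 × EuclideanSpace ℝ (Fin 3))
  haveI hR : IsManifold (𝓡 4) ∞ R := Rechart.isManifold f _ hf hf'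
  have hT : IsOrientable ((𝓡 1).prod (𝓡 3))
      (Metric.sphere (0 : EuclideanSpace ℝ (Fin 2)) 1 × EuclideanSpace ℝ (Fin 3)) :=
    (isOrientable_sphere_holds 1).prod (isOrientable_euclideanSpace 3)
  have hRo : IsOrientable (𝓡 4) R := IsOrientable.rechart f L _ hIf hT
  let Φ : R ≃ₘ⟮𝓡 4, (𝓡 1).prod (𝓡 3)⟯
      (Metric.sphere (0 : EuclideanSpace ℝ (Fin 2)) 1 × EuclideanSpace ℝ (Fin 3)) :=
    { toFun := Rechart.out f _
      invFun := Rechart.into f _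
      left_inv := fun x => Rechart.into_out f _ x
      right_inv := fun x => Rechart.out_into f _ x
      contMDiff_toFun := Rechart.contMDiff_out f _ hf hf'
      contMDiff_invFun := Rechart.contMDiff_into f _ hf hf' }
  exact ⟨R, inferInstance, inferInstance, hR, hRo, ⟨Φ⟩⟩

/-- **`isOrientable_of_isCircleSurgery_four` holds** (Hirsch 1976, Ch. 4 §4 and Ch. 5 §1): if
`P` is obtained from `X` by surgery on the circle `ℓ` and `P` is orientable, then `X` is
orientable — `X` is covered by `X ∖ ℓ(S¹)` (oriented by pulling back along the gluing map into
`P`) and the tube `ν(S¹ × ℝ³)` (orientable), which meet in the connected set `ν(S¹ × (ℝ³ ∖ 0))`.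
[cite: HirschDT1976, §4.4 p. 101 and Thm. 4.3; Ch. 5 §1] -/
theorem isOrientable_of_isCircleSurgery_four_holds : isOrientable_of_isCircleSurgery_four := by
  intro X _ _ _ _ _ ℓ P _ _ _ _ _ hsurg hP
  obtain ⟨ν, jA, jB, hA, hAo, hB, hBo, hU, hR⟩ := hsurg
  -- `U = X ∖ ℓ(S¹)` is oriented by pulling back along `jA`
  have hUo : IsOrientable (𝓡 4) ν.complement := IsOrientable.of_isSmoothEmbedding hA hP
  -- `V = ν(S¹ × ℝ³)` is orientable
  have hVo : IsOrientable (𝓡 4) (rangeOpens ν.toFun ν.isOpen_range) := by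
    obtain ⟨R, _, _, _, hRo, ⟨Φ⟩⟩ := exists_rechart_tube_diffeomorph
    exact hRo.of_diffeomorph (Φ.trans (rangeDiffeomorph ν.isSmoothEmbedding ν.isOpen_range))
      (by simp)
  -- the two open sets cover `X`
  have hcover : ∀ x, x ∈ ν.complement ∨ x ∈ rangeOpens ν.toFun ν.isOpen_range := by
    intro x
    by_cases hx : x ∈ Set.range ℓ
    · obtain ⟨u, rfl⟩ := hx
      exact Or.inr ⟨(u, 0), ν.apply_zero u⟩
    · exact Or.inl hx
  -- and meet in `ν(S¹ × (ℝ³ ∖ 0))`, which is preconnected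
  have hset : (ν.complement : Set X) ∩ (rangeOpens ν.toFun ν.isOpen_range : Set X) =
      ν.toFun '' ((Set.univ : Set (Metric.sphere (0 : EuclideanSpace ℝ (Fin 2)) 1)) ×ˢ
        ({0}ᶜ : Set (EuclideanSpace ℝ (Fin 3)))) := by
    ext x
    simp only [coe_rangeOpens, Set.mem_inter_iff, Set.mem_range, Set.mem_image, Set.mem_prod,
      Set.mem_univ, true_and, Set.mem_compl_iff, Set.mem_singleton_iff, SetLike.mem_coe,
      CircleNbhd.mem_complement_iff]
    constructor
    · rintro ⟨hxℓ, ⟨u, v⟩, rfl⟩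
      refine ⟨(u, v), ?_, rfl⟩
      rintro rfl
      exact hxℓ ⟨u, (ν.apply_zero u).symm⟩
    · rintro ⟨⟨u, v⟩, hv, rfl⟩
      refine ⟨?_, (u, v), rfl⟩
      rintro ⟨u', hu'⟩
      have h :=
        ν.isSmoothEmbedding.isEmbedding.injective ((ν.apply_zero u').trans hu')
      -- `(u', 0) = (u, v)`
      exact hv (congrArg Prod.snd h).symm
  have hconn : IsPreconnected
      ((ν.complement : Set X) ∩ (rangeOpens ν.toFun ν.isOpen_range : Set X)) := by
    rw [hset]
    refine IsPreconnected.image ?_ _ ν.continuous.continuousOn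
    refine IsPreconnected.prod ?_ ?_
    · haveI : PreconnectedSpace (Metric.sphere (0 : EuclideanSpace ℝ (Fin 2)) 1) :=
        Subtype.preconnectedSpace
          (isPreconnected_sphere (one_lt_rank_euclideanSpace_loopSurgery 0)
            (0 : EuclideanSpace ℝ (Fin 2)) 1)
      exact isPreconnected_univ
    · exact (isConnected_compl_singleton_of_one_lt_rank (one_lt_rank_euclideanSpace_loopSurgery 1)
        (0 : EuclideanSpace ℝ (Fin 3))).isPreconnected
  exact IsOrientable.of_opens_cover_of_isPreconnected _ _ hcover hUo hVo hconn

end Literature.Topology.FourManifolds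

end
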